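/- Lead `ym-line-cbag-p1`, route `ColdBoxAllGroups`, crux `BoxFloorAllGroups` (stmt-QuantumFields-22254), line `birth`: the registered
load-bearing stub S2 `stub_boxDirichletDominationAbsG` — PROVED (assembly B9b of the bricks B1–B9a, B9c). -/
import Summits.QuantumFields.YangMills.Theorems.ColdBoxAllGroupsBoxFloorAllGroupsCoreG
import Summits.QuantumFields.YangMills.Theorems.ColdBoxAllGroupsBoxFloorAllGroupsRepresentationGBall
import Summits.QuantumFields.YangMills.Theorems.ColdBoxAllGroupsBoxFloorAllGroupsGoodReductionG
import Summits.QuantumFields.YangMills.Theorems.ColdBoxAllGroupsBoxFloorAllGroupsChartWindowG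
import Summits.QuantumFields.YangMills.Theorems.ColdBoxAllGroupsBoxFloorAllGroupsChartDensityJ
import Summits.QuantumFields.YangMills.Theorems.WeakCouplingRatesColdBoxExponents

/-!
# Crux `BoxFloorAllGroups` (stmt-QuantumFields-22254), line `birth`, skeleton v5: the registered load-bearing stub
# `stub_boxDirichletDominationAbsG` — PROVED (every compact simple `G`, every faithful unitary lattice representation)

For every compact simple `G` (tree sense) and `r : LatticeRep G` there are `θ₀ = 1/100` and, for `0 < θ ≤ θ₀`, `κ = 9θ` with: eventually in
`β`, for every `T ≤ H = ⌈β^θ⌉`, `|β²·boxPlaqCov r.ρ β H T − (D/4)·boxDirCircSqCov H T| ≤ β^{−κ}`, `D = dimE r.ρ` — the one-scale Laplace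
expansion of the cold-wall box in the temporal-forest gauge and the exponential chart (port of the `SU(2)` theorem
`boxDirichletDominationAbs`).  Assembly of the landed bricks of the line (width seats w2, w3 and the lead):
* B5-J `exists_chartMeasureE_restrict_closedBall_eq_withDensity` (w2; Helgason's Jacobian `J`, `|log J| ≤ 2C₂‖a‖²`);
* B4' `integral_cond_boxState_eq_integral_tilted_G'` (w3; the representation of the conditioned box state as a tilted conditioned `gaussD`),
  with its link-window hypothesis discharged eventually by `eventually_linkWindow_subset_image_expChart` (w3, ChartWindowG);
* B2 `abs_boxPlaqCov_sub_cond_le_of_rep`, `boxState_coldGoodSetG_ne_zero` (w3; large fields are rare, B1);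
* B9a `abs_boxPlaqCov_sub_dirCircSqCov_le_coreG` (lead; the deterministic core, consuming GaussSideD/TiltBoundG/GaussTailD/CubicG);
* B9c `eventually_oneScale_boundsG` (the exponent window at `ε = 3θ`, `m = 2η_β`, `R = β^{3θ}/(2(√D+1))`, and `RHS ≤ β^{−9θ}`).
The hypothesis (S1) of the registered signature is a landed theorem (`stub_boxLargeFieldRarityG`, w3) and is not used directly.
No sorry; no new definition; standard axioms.  NOT a claim about the Yang–Mills mass gap (rung-level support, RECORD label R2xi-G).
-/

set_option autoImplicit false

noncomputable section

open MeasureTheory ProbabilityTheory Finset Real Filter Topology Metric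
open Literature.Probability.LatticeModels (Site)
open Literature.MathematicalPhysics.QuantumLattice
open Literature.MathematicalPhysics.QuantumFieldTheory
open Literature.MathematicalPhysics.QuantumFieldTheory.LatticeMaxwell
open Literature.MathematicalPhysics.QuantumFieldTheory.AxialGauge
open Summit.QuantumFields.YangMills.Theorems.WeakCouplingRates
open Summit.QuantumFields.YangMills.Theorems.FreeEnergyLogCoefficient

namespace Summit.QuantumFields.YangMills.Theorems.ColdBoxAllGroups

/-- **B9c «ExponentsG» (WANTED — statement fixed by the lead; pure real analysis, no measure theory).**  The one-scale window of the
`G`-generic expansion at `ε = 3θ`, link radius `m = 2η_β`, Gaussian radius `R = β^{3θ}/(2(√D+1))`, and the final smallness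
`RHS(β) ≤ β^{−9θ}` of brick B9a «CoreG», hold eventually in `β` for every `0 < θ ≤ 1/100` and all constants `N, D, r₂, C₂`. -/
theorem eventually_oneScale_boundsG (N D : ℕ) {θ r₂ C₂ : ℝ} (hθ : 0 < θ) (hθ1 : θ ≤ 1 / 100) (hr₂ : 0 < r₂) (hC₂ : 0 < C₂) :
    ∀ᶠ β : ℝ in atTop, 1 ≤ β ∧
      -- (2) link radius m = 2η ≤ 1/4 and ≤ r₂, and C₂ m² ≤ 1/2
      2 * ((12 * (⌈β ^ θ⌉₊ : ℝ) ^ 2 + 2 * ⌈β ^ θ⌉₊ + 1) * (Real.sqrt 2 * Real.sqrt (β ^ (2 * (3 * θ) - 1)))) ≤ 1 / 4 ∧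
      2 * ((12 * (⌈β ^ θ⌉₊ : ℝ) ^ 2 + 2 * ⌈β ^ θ⌉₊ + 1) * (Real.sqrt 2 * Real.sqrt (β ^ (2 * (3 * θ) - 1)))) ≤ r₂ ∧
      -- (3) Gaussian link radius mE ≤ m
      Real.sqrt D * ((12 * (⌈β ^ θ⌉₊ : ℝ) ^ 2 + 2 * ⌈β ^ θ⌉₊ + 1) * (β ^ (3 * θ) / (2 * (Real.sqrt D + 1)))) / Real.sqrt β ≤
        2 * ((12 * (⌈β ^ θ⌉₊ : ℝ) ^ 2 + 2 * ⌈β ^ θ⌉₊ + 1) * (Real.sqrt 2 * Real.sqrt (β ^ (2 * (3 * θ) - 1)))) ∧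
      -- (4) Gaussian window
      (D : ℝ) / 2 * (β ^ (3 * θ) / (2 * (Real.sqrt D + 1))) ^ 2 / β +
          190 * (Real.sqrt D * ((12 * (⌈β ^ θ⌉₊ : ℝ) ^ 2 + 2 * ⌈β ^ θ⌉₊ + 1) * (β ^ (3 * θ) / (2 * (Real.sqrt D + 1)))) / Real.sqrt β) ^ 3 <
        β ^ (2 * (3 * θ) - 1) ∧
      -- (5) Gaussian bad mass p < 1
      240 * (D : ℝ) * (2 * (⌈β ^ θ⌉₊ : ℝ) + 1) ^ 4 * Real.exp (-(β ^ (3 * θ) / (2 * (Real.sqrt D + 1))) ^ 2 / 2) < 1 ∧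
      -- (6) the final bound of CoreG with w replaced by its card upper bound is ≤ β^{-9θ}
      β ^ 2 * (24 * (N : ℝ) ^ 2 * Real.exp (-(β ^ (3 * θ)))) +
          3 * (β ^ (2 * (3 * θ))) ^ 2 * (Real.exp (2 * ((120 * (2 * (⌈β ^ θ⌉₊ : ℝ) + 1) ^ 4) *
              (190 * β * (2 * ((12 * (⌈β ^ θ⌉₊ : ℝ) ^ 2 + 2 * ⌈β ^ θ⌉₊ + 1) * (Real.sqrt 2 * Real.sqrt (β ^ (2 * (3 * θ) - 1))))) ^ 3) +
            (4 * (2 * (⌈β ^ θ⌉₊ : ℝ) + 1) ^ 4) *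
              (2 * C₂ * (2 * ((12 * (⌈β ^ θ⌉₊ : ℝ) ^ 2 + 2 * ⌈β ^ θ⌉₊ + 1) * (Real.sqrt 2 * Real.sqrt (β ^ (2 * (3 * θ) - 1))))) ^ 2))) - 1) +
          6 * (β ^ (2 * (3 * θ))) ^ 2 * (240 * (D : ℝ) * (2 * (⌈β ^ θ⌉₊ : ℝ) + 1) ^ 4 * Real.exp (-(β ^ (3 * θ) / (2 * (Real.sqrt D + 1))) ^ 2 / 2)) +
          2 * (190 * β * (2 * ((12 * (⌈β ^ θ⌉₊ : ℝ) ^ 2 + 2 * ⌈β ^ θ⌉₊ + 1) * (Real.sqrt 2 * Real.sqrt (β ^ (2 * (3 * θ) - 1))))) ^ 3) *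
            (β ^ (2 * (3 * θ)) + D) +
          Real.sqrt (240 * (D : ℝ) * (2 * (⌈β ^ θ⌉₊ : ℝ) + 1) ^ 4 * Real.exp (-(β ^ (3 * θ) / (2 * (Real.sqrt D + 1))) ^ 2 / 2)) *
            (2 * β ^ (2 * (3 * θ)) * D + 3 * (D : ℝ) ^ 2 + (D : ℝ) ^ 2) ≤
        β ^ (-(9 * θ)) := by
  sorry

/-- Card bookkeeping: the tilt size with the actual numbers of plaquettes / free links is at most the one with the bounds `120(2H+1)⁴` /
`4(2H+1)⁴` (`τ, ℓ ≥ 0`). -/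
theorem tiltSize_le_cardBound (H : ℕ) {τ ℓ : ℝ} (hτ : 0 ≤ τ) (hℓ : 0 ≤ ℓ) :
    (#(plaquettesTouching (boxEdges 4 (2 * H + 1))) : ℝ) * τ + (Fintype.card (ColdFreeIdx H) : ℝ) * ℓ ≤
      120 * (2 * (H : ℝ) + 1) ^ 4 * τ + 4 * (2 * (H : ℝ) + 1) ^ 4 * ℓ := by
  have hP : (#(plaquettesTouching (boxEdges 4 (2 * H + 1))) : ℝ) ≤ 120 * (2 * (H : ℝ) + 1) ^ 4 := by
    have h := card_plaquettesTouching_boxEdges_le (2 * H + 1)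
    have h' : ((#(plaquettesTouching (boxEdges 4 (2 * H + 1))) : ℕ) : ℝ) ≤ ((120 * (2 * H + 1) ^ 4 : ℕ) : ℝ) := by exact_mod_cast h
    push_cast at h'
    exact h'
  have hN : (Fintype.card (ColdFreeIdx H) : ℝ) ≤ 4 * (2 * (H : ℝ) + 1) ^ 4 := by
    have h1 : Fintype.card (ColdFreeIdx H) ≤ Fintype.card ↥(boxEdges 4 (2 * H + 1)) := Fintype.card_subtype_le _
    rw [Fintype.card_coe] at h1
    have h2 := card_boxEdges_four_le (2 * H + 1)
    have h' : ((Fintype.card (ColdFreeIdx H) : ℕ) : ℝ) ≤ ((4 * (2 * H + 1) ^ 4 : ℕ) : ℝ) := by exact_mod_cast h1.trans h2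
    push_cast at h'
    exact h'
  nlinarith

/-- **Stub S2 of crux `BoxFloorAllGroups` (line `birth`, skeleton v4/v5, registered signature verbatim) — the ABSOLUTE one-scale
comparison of the cold-wall box with its own temporal-gauge Dirichlet Gaussian, every compact simple `G`.**  Given S1 (large fields are
rare; a landed theorem, unused here), for every `(G, r)` there is `θ₀ > 0` (`= 1/100`) such that for `0 < θ ≤ θ₀` some `κ > 8θ` (`= 9θ`)
satisfies, eventually in `β`, for every `T ≤ H = ⌈β^θ⌉`: `|β²·boxPlaqCov r.ρ β H T − (D/4)·boxDirCircSqCov H T| ≤ β^{−κ}`. -/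
theorem stub_boxDirichletDominationAbsG :
    (∀ (G : Type) [Group G] [TopologicalSpace G] [IsTopologicalGroup G] [CompactSpace G],
      IsCompactSimpleLieGroup G →
      letI : MeasurableSpace G := borel G
      haveI : BorelSpace G := ⟨rfl⟩
      ∀ r : LatticeRep G, ∀ θ ε : ℝ, 0 < θ → 2 * θ < ε → ∃ β₀ : ℝ, ∀ β : ℝ, β₀ ≤ β →
        (boxState r.ρ β ⌈β ^ θ⌉₊).real
            {U | ∃ p ∈ plaquettesTouching (AxialGauge.boxEdges 4 (2 * ⌈β ^ θ⌉₊ + 1)),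
              β ^ (2 * ε - 1) ≤ (r.N : ℝ) - plaquetteObs r.ρ p.1 p.2.1.1 p.2.1.2 U} ≤ Real.exp (-(β ^ ε))) →
    ∀ (G : Type) [Group G] [TopologicalSpace G] [IsTopologicalGroup G] [CompactSpace G],
    IsCompactSimpleLieGroup G →
    letI : MeasurableSpace G := borel G
    haveI : BorelSpace G := ⟨rfl⟩
    ∀ r : LatticeRep G, ∃ θ₀ : ℝ, 0 < θ₀ ∧ ∀ θ : ℝ, 0 < θ → θ ≤ θ₀ → ∃ κ : ℝ, 8 * θ < κ ∧ ∃ β₀ : ℝ, ∀ β : ℝ, β₀ ≤ β →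
      ∀ T : ℕ, T ≤ ⌈β ^ θ⌉₊ →
        |β ^ 2 * boxPlaqCov r.ρ β ⌈β ^ θ⌉₊ T - (dimE r.ρ : ℝ) / 4 * boxDirCircSqCov ⌈β ^ θ⌉₊ T| ≤ β ^ (-κ) := by
  intro _ G _ _ _ _ _
  letI : MeasurableSpace G := borel G
  haveI : BorelSpace G := ⟨rfl⟩
  intro r
  haveI : SecondCountableTopology (Matrix (Fin r.N) (Fin r.N) ℂ) := inferInstanceAs (SecondCountableTopology (Fin r.N → Fin r.N → ℂ))
  haveI : SecondCountableTopology G := (r.continuous.isClosedEmbedding r.injective).isEmbedding.secondCountableTopology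
  refine ⟨1 / 100, by norm_num, fun θ hθ hθ1 => ⟨9 * θ, by linarith, ?_⟩⟩
  set ρ := r.ρ with hρdef
  have hρc : Continuous ρ := r.continuous
  have hinj : Function.Injective ρ := r.injective
  have hρu : ∀ g, ρ g ∈ Matrix.unitaryGroup (Fin r.N) ℂ := r.mem_unitary
  -- the chart density (B5-J)
  obtain ⟨r₂, C₂, cH, hr₂, -, hC₂, hcH, J, hJc, hJb, hJhalf, hdens⟩ :=
    exists_chartMeasureE_restrict_closedBall_eq_withDensity ρ hρc hinj hρu
  -- eventual facts: the exponent window (B9c), the link window (ChartWindowG), the conditioning (B2)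
  have hwin5 : 2 * θ + 3 * θ < 1 / 2 := by linarith
  obtain ⟨β₁, hE⟩ := Filter.eventually_atTop.1 ((eventually_oneScale_boundsG r.N (dimE ρ) hθ hθ1 hr₂ hC₂).and
    (eventually_linkWindow_subset_image_expChart ρ hρc hinj hρu (ε := 3 * θ) hθ.le hwin5 one_pos))
  obtain ⟨β₂, hcondE⟩ := abs_boxPlaqCov_sub_cond_le_of_rep ρ hρc hρu hθ (by linarith : 2 * θ < 3 * θ)
  obtain ⟨β₃, hG0E⟩ := boxState_coldGoodSetG_ne_zero ρ hρc hρu hθ (by linarith : 2 * θ < 3 * θ)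
  refine ⟨max β₁ (max β₂ β₃), fun β hβ T hT => ?_⟩
  have hb₁ : β₁ ≤ β := (le_max_left _ _).trans hβ
  have hb₂ : β₂ ≤ β := ((le_max_left _ _).trans (le_max_right _ _)).trans hβ
  have hb₃ : β₃ ≤ β := ((le_max_right _ _).trans (le_max_right _ _)).trans hβ
  obtain ⟨⟨hβ1, hm4, hmr₂, hmEm, hwin, hp1, hfinal⟩, -, hball⟩ := hE β hb₁
  -- names for the one-scale quantities
  set H : ℕ := ⌈β ^ θ⌉₊ with hHdef
  set η : ℝ := (12 * (H : ℝ) ^ 2 + 2 * H + 1) * (Real.sqrt 2 * Real.sqrt (β ^ (2 * (3 * θ) - 1))) with hηdef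
  set m : ℝ := 2 * η with hmdef
  set R : ℝ := β ^ (3 * θ) / (2 * (Real.sqrt (dimE ρ) + 1)) with hRdef
  set p : ℝ := 240 * (dimE ρ : ℝ) * (2 * (H : ℝ) + 1) ^ 4 * Real.exp (-R ^ 2 / 2) with hpdef
  set ℓ : ℝ := 2 * C₂ * m ^ 2 with hℓdef
  have hβ0 : 0 < β := by linarith
  have hH : 1 ≤ H := by
    have := (one_le_ceil_rpow_and_le (A := θ) hβ1 hθ.le).1
    exact_mod_cast this
  have hη0 : 0 < η := by
    have : 0 < Real.sqrt (β ^ (2 * (3 * θ) - 1)) := Real.sqrt_pos.2 (Real.rpow_pos_of_pos hβ0 _)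
    positivity
  have hm0 : 0 < m := by positivity
  have hℓ0 : 0 ≤ ℓ := by positivity
  have hR0 : 0 ≤ R := by positivity
  have hmE4 : Real.sqrt (dimE ρ) * ((12 * (H : ℝ) ^ 2 + 2 * H + 1) * R) / Real.sqrt β ≤ 1 / 4 := hmEm.trans hm4
  -- the density hypotheses at radius `m`
  have hgpos : ∀ a : EuclideanSpace ℝ (Fin (dimE ρ)), ‖a‖ ≤ m → 0 < J a := fun a ha => by
    linarith [(hJhalf a (ha.trans hmr₂)).1]
  have hg : ∀ a : EuclideanSpace ℝ (Fin (dimE ρ)), ‖a‖ ≤ m → |Real.log (J a)| ≤ ℓ := fun a ha => by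
    refine (abs_log_jacobian_le hJb hJhalf a (ha.trans hmr₂)).trans ?_
    rw [hℓdef]
    have : ‖a‖ ^ 2 ≤ m ^ 2 := pow_le_pow_left₀ (norm_nonneg _) ha 2
    nlinarith
  have hc0 : ENNReal.ofReal cH ≠ 0 := by rw [ENNReal.ofReal_ne_zero_iff]; exact hcH
  have hdensm := hdens m hm0 hmr₂
  -- the two charged events
  have hG0 : boxState ρ β H (coldGoodSetG ρ H β (3 * θ)) ≠ 0 := hG0E β hb₃
  haveI : IsProbabilityMeasure (gaussD H (dimE ρ)) := isProbabilityMeasure_gaussD H (dimE ρ)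
  have hSm : MeasurableSet (goodTE ρ H β (3 * θ) ∩ {t | ∀ e, ‖unscaleTE H (dimE ρ) β t e‖ ≤ m}) :=
    (measurableSet_goodTE ρ hρc hinj β (3 * θ)).inter (measurableSet_ball_unscaleTE (dimE ρ) β m)
  have hpS : (gaussD H (dimE ρ)).real (goodTE ρ H β (3 * θ) ∩ {t | ∀ e, ‖unscaleTE H (dimE ρ) β t e‖ ≤ m})ᶜ ≤ p :=
    gaussD_real_compl_goodTE_inter_ball_le ρ hρc hβ0 hH hR0 hmE4 hmEm hwin
  have hγ : gaussD H (dimE ρ) (goodTE ρ H β (3 * θ) ∩ {t | ∀ e, ‖unscaleTE H (dimE ρ) β t e‖ ≤ m}) ≠ 0 :=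
    measure_ne_zero_of_real_compl_lt_one _ hSm (hpS.trans_lt hp1)
  -- the representation (B4') at radius `m = 2η`
  have hrep : ∀ X : LGConfig 4 G → ℝ, Measurable X → IsZdGaugeInvariant X → (∀ U, 0 ≤ X U) →
      ∫ U, X U ∂((boxState ρ β H)[|coldGoodSetG ρ H β (3 * θ)]) =
        ∫ t, X (cfgTE ρ H β t) ∂(((gaussD H (dimE ρ))[|(goodTE ρ H β (3 * θ) ∩ {t | ∀ e, ‖unscaleTE H (dimE ρ) β t e‖ ≤ m})]).tilted
          ((goodTE ρ H β (3 * θ) ∩ {t | ∀ e, ‖unscaleTE H (dimE ρ) β t e‖ ≤ m}).indicator (tiltWE ρ H J β))) :=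
    fun X hXm hXinv hX0 => integral_cond_boxState_eq_integral_tilted_G' ρ hρc hinj hρu hβ0 hH hm4 hball hJc.measurable hgpos hc0
      ENNReal.ofReal_ne_top hdensm hG0 hγ hXm hXinv hX0
  -- the deterministic core (B9a)
  have hcore := abs_boxPlaqCov_sub_dirCircSqCov_le_coreG ρ hρc hinj hρu (ε := 3 * θ) (m := m) (ℓ := ℓ) (R := R) (p := p) (T := T)
    (c₀ := 24 * (r.N : ℝ) ^ 2 * Real.exp (-(β ^ (3 * θ)))) hJc.measurable hβ1 hH hT hm0.le hm4 hℓ0 hg hR0 hmE4 hmEm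
    hwin le_rfl hp1 hrep (hcondE β hb₂ T)
  -- the final smallness (B9c): monotonicity in the tilt size, then `≤ β^{−9θ}`
  refine hcore.trans (le_trans ?_ hfinal)
  have hτ0 : 0 ≤ 190 * β * m ^ 3 := by positivity
  have hw := tiltSize_le_cardBound H hτ0 hℓ0
  have hexp : Real.exp (2 * ((#(plaquettesTouching (boxEdges 4 (2 * H + 1))) : ℝ) * (190 * β * m ^ 3) +
      (Fintype.card (ColdFreeIdx H) : ℝ) * ℓ)) ≤
      Real.exp (2 * (120 * (2 * (H : ℝ) + 1) ^ 4 * (190 * β * m ^ 3) + 4 * (2 * (H : ℝ) + 1) ^ 4 * ℓ)) :=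
    Real.exp_le_exp.2 (by linarith)
  have hM0 : 0 ≤ 3 * (β ^ (2 * (3 * θ))) ^ 2 := by positivity
  have key := mul_le_mul_of_nonneg_left (sub_le_sub_right hexp 1) hM0
  linarith [key]

end Summit.QuantumFields.YangMills.Theorems.ColdBoxAllGroups

end
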